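import Literature.Analysis.Complex.ArgumentPrincipleRectangle
import HarnessLib

/-!
# Variation of the argument along a vertical segment where `Re g ≥ 0`

Trunk T-ANALYSIS support (`Literature/Analysis/Complex`). Vertical companion of
`Literature.Analysis.Complex.abs_im_integral_logDeriv_le_pi_of_re_nonneg` (`BacklundArgVariation.lean`,
horizontal segments): if `g` is analytic and non-zero at every point of the vertical segment
`{x} × [c, d]` and `Re g ≥ 0` there, then the change of `arg g` along it,
`∫_c^d Re (g'/g)(x+it) dt = arg g(x+id) − arg g(x+ic)` (principal arguments, both in `[−π/2, π/2]`),
is at most `π` in absolute value (`abs_integral_re_logDeriv_vertical_le_pi_of_re_nonneg`). This is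
the right-edge estimate of Levinson's method (Conrey, *J. Number Theory* 16 (1983), §4, before (3):
"`|Δ arg V(σ₀ + it)| < π` if `σ₀` is large enough", where `|V − 1| < 1`).

## References

* E. C. Titchmarsh, *The Theory of the Riemann Zeta-Function*, 2nd ed. (1986), §9.4.
* J. B. Conrey, J. Number Theory 16 (1983), §4 (3). [Conrey1983]
-/

noncomputable section

open Complex Set MeasureTheory intervalIntegral

namespace Literature.Analysis.Complex

variable {c d : ℝ}

/-- **`|∫_c^d Re (g'/g)(x+it) dt| ≤ π` when `Re g ≥ 0` on the vertical segment `{x} × [c,d]`**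
(`g` analytic and non-zero there): the principal logarithm is a primitive of `g'/g` along the
segment (`Literature.Analysis.Complex.integral_logDeriv_vertical`) and both end arguments lie in
`[−π/2, π/2]`. [cite: Titchmarsh1986, §9.4] -/
theorem abs_integral_re_logDeriv_vertical_le_pi_of_re_nonneg {g : ℂ → ℂ} (x : ℝ) (hcd : c ≤ d)
    (hg : ∀ y ∈ Icc c d, AnalyticAt ℂ g (x + y * I))
    (h0 : ∀ y ∈ Icc c d, g (x + y * I) ≠ 0)
    (hre : ∀ y ∈ Icc c d, 0 ≤ (g (x + y * I)).re) :
    |∫ y : ℝ in c..d, (deriv g (x + y * I) / g (x + y * I)).re| ≤ Real.pi := by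
  have hs : ∀ y ∈ Icc c d, g (x + y * I) ∈ slitPlane := by
    intro y hy
    rw [mem_slitPlane_iff]
    rcases (hre y hy).eq_or_lt with h | h
    · right
      intro him
      exact h0 y hy (Complex.ext (by simpa using h.symm) (by simpa using him))
    · exact Or.inl h
  -- continuity of the integrand, to exchange `Re` and the integral
  have hcont : ContinuousOn (fun y : ℝ ↦ deriv g (x + y * I) / g (x + y * I)) (Icc c d) := by
    intro y hy
    have hlin : Continuous fun y : ℝ ↦ (x : ℂ) + y * I := by fun_prop
    exact (((hg y hy).deriv.continuousAt.comp (f := fun y : ℝ ↦ (x : ℂ) + y * I) hlin.continuousAt).div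
      ((hg y hy).continuousAt.comp (f := fun y : ℝ ↦ (x : ℂ) + y * I) hlin.continuousAt)
      (h0 y hy)).continuousWithinAt
  have hcomm := Complex.reCLM.intervalIntegral_comp_comm (hcont.intervalIntegrable_of_Icc (μ := volume) hcd)
  simp only [Complex.reCLM_apply] at hcomm
  rw [hcomm, ← I_mul_im, integral_logDeriv_vertical x hcd hg hs, sub_im, log_im, log_im]
  have h1 := abs_arg_le_pi_div_two_iff.2 (hre d ⟨hcd, le_rfl⟩)
  have h2 := abs_arg_le_pi_div_two_iff.2 (hre c ⟨le_rfl, hcd⟩)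
  rw [abs_le] at h1 h2 ⊢
  constructor <;> linarith [h1.1, h1.2, h2.1, h2.2]

/-- In particular, if `‖g − 1‖ < 1` on the segment then `Re g > 0` there and the bound applies.
[cite: Conrey1983, §4 (3)] -/
theorem abs_integral_re_logDeriv_vertical_le_pi_of_norm_sub_one_lt {g : ℂ → ℂ} (x : ℝ) (hcd : c ≤ d)
    (hg : ∀ y ∈ Icc c d, AnalyticAt ℂ g (x + y * I))
    (h1 : ∀ y ∈ Icc c d, ‖g (x + y * I) - 1‖ < 1) :
    |∫ y : ℝ in c..d, (deriv g (x + y * I) / g (x + y * I)).re| ≤ Real.pi := by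
  have hre : ∀ y ∈ Icc c d, 0 < (g (x + y * I)).re := by
    intro y hy
    have h := h1 y hy
    have hle : |(g (x + y * I) - 1).re| ≤ ‖g (x + y * I) - 1‖ := Complex.abs_re_le_norm _
    rw [sub_re, one_re] at hle
    have := (abs_lt.1 (lt_of_le_of_lt hle h)).1
    linarith
  refine abs_integral_re_logDeriv_vertical_le_pi_of_re_nonneg x hcd hg (fun y hy h ↦ ?_)
    (fun y hy ↦ (hre y hy).le)
  have := hre y hy
  rw [h, zero_re] at this
  exact lt_irrefl 0 this

end Literature.Analysis.Complex

end
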